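import Summits.FinalStateConjecture.FinalStateConjecture.Theorems.SwallowTheDatumKerrShieldedDataExistAssemblyZones
import Summits.FinalStateConjecture.FinalStateConjecture.Theorems.SwallowTheDatumKerrShieldedDataExistAssemblyLeafZone
import Summits.FinalStateConjecture.FinalStateConjecture.Theorems.SwallowTheDatumKerrShieldedDataExistAssemblyKSZone
import Summits.FinalStateConjecture.FinalStateConjecture.Theorems.SwallowTheDatumKerrShieldedDataExistAssemblyProfile
import Literature.Geometry.Lorentzian.ModelData
import HarnessLib

/-!
# `KerrShieldedDataExist`, line `plug-the-second-sheet` — stub `stub_assembly`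

Stub 5b of the lead's skeleton for crux `stmt-FinalStateConjecture-10055` (the ASSEMBLY): given the plugged datum
`D₀` (`PlugData`: vacuum on `E3`, exactly isotropic Schwarzschild `((1 + M/2ρ)⁴δ, 0)` on `{ρ > ρ₃}`, `ρ₃ < M/40`), the
bridge datum of `stub_bridgeAnnulus` (hypothesis `hBridge`), the Ricci-flatness of the Kerr–Schild charts and the
induced-vacuum-data packaging (`hRic`, `hInd`), and, at a junction radius `r₁ ∈ (3M/4, 2M)`, the crux's pinned
spacelike graph `ψ = Negative.graph M 0 r₁` with a future unit normal represented by `N₀`, there is ONE datum `D` on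
`E3` which solves the vacuum constraints, is exactly `((1 + M/2ρ)⁴δ, 0)` outside the ball of radius `7M`, and
satisfies the shielding block of the crux verbatim with `a = 0`, this `r₁`, the literal height `T`, `ψ`, `ν = N₀` and
the end chart `φ(y) = (S(|y|)/|y|) y` of `…AssemblyProfile`.

Construction (`stub_assembly`): four radial zones glued by `…AssemblyZones` (plug `D₀` | bridge `Db` | Kerr–Schild
slice data `(hRep, kRep)` of `…AssemblyKSZone` | the leaf zone `φ_*(ψ^* g, K_{N₀})` of `…AssemblyLeafZone`), which agree
exactly on the overlaps; the block's pull-back identities hold by construction of the leaf zone, the far clause by the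
isotropic re-reading of the Boyer–Lindquist end.

References: R. Bartnik, J. Isenberg, *The constraint equations* (2004), §2; G. B. Cook, Living Rev. Relativ. 3 (2000) 5,
§3.2.2; R. M. Wald, *General Relativity* (1984), §6.4; M. Dafermos, I. Rodnianski, arXiv:0811.0354, §5.1.
-/

-- the doubled `FinalStateConjecture` path component is the summit/problem naming scheme, not a mistake
set_option linter.dupNamespace false

noncomputable section

open Set Filter Topology TopologicalSpace
open scoped Manifold ContDiff Topology InnerProductSpace
open Literature.Geometry.Lorentzian
open Literature.Geometry.Manifold (OpenSubmanifold.mfderiv_subtype_val OpenSubmanifold.mdifferentiableAt_subtype_val)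
open Summit.FinalStateConjecture.FinalStateConjecture.Theorems.KerrShieldedDataExist

namespace Summit.FinalStateConjecture.FinalStateConjecture.Theorems.SwallowTheDatum

open Assembly in
/-- **Stub `stub_assembly` of line `plug-the-second-sheet` (crux `stmt-FinalStateConjecture-10055`): the ASSEMBLY.**
Plug + bridge + Kerr–Schild zone + leaf zone glued on `E3` (`Assembly.exists_zonesData`), with the crux's shielding
block (`a = 0`, `T = Negative.bentHeight M 0` literally, `ψ = Negative.graph M 0 r₁`, `ν = N₀`, end chart
`φ = (S(|y|)/|y|) y`: compact complement `= closedBall r₁`, open embedding, smooth; pull-back identities by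
construction of the leaf zone, `Assembly.exists_leafZoneData`) and the far clause with `R = 7M`.
[cite: BartnikIsenberg2004, §2] [cite: Cook2000, §3.2.2] [cite: Wald1984, §6.4] -/
theorem stub_assembly :
    ∀ [Kerr.Facts] (M ρ₃ : ℝ) (D₀ : InitialDataSet (𝓡 3) E3) (hM : 0 ≤ M), 0 < M → 0 < ρ₃ → ρ₃ < M / 40 →
      (∀ [D₀.metric.HasLeviCivita], D₀.IsVacuumConstraintSolution) →
      (∀ y : E3, ρ₃ < ‖y‖ →
        (∀ v w : E3, D₀.h.inner y v w = Schwarzschild.conformalFactor M y ^ 4 * ⟪v, w⟫_ℝ) ∧ D₀.k y = 0) →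
      (∀ (r₀ : ℝ) [(Kerr.smoothMetric M 0 r₀).HasLeviCivita] (x : Kerr.region 0 r₀),
        (Kerr.smoothMetric M 0 r₀).ricci x = 0) →
      (∀ (r₀ : ℝ) (U : TopologicalSpace.Opens E3) (Φ N : E3 → E4)
        (f : U → Kerr.region 0 r₀) (ν : NormalField 𝓘(ℝ, E4) f),
        (∀ [(Kerr.smoothMetric M 0 r₀).HasLeviCivita] (x : Kerr.region 0 r₀), (Kerr.smoothMetric M 0 r₀).ricci x = 0) →
        (∀ y : U, ((f y : Kerr.region 0 r₀) : E4) = Φ y) → (∀ y : U, ν y = N y) →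
        ContDiffOn ℝ ∞ Φ (U : Set E3) → ContDiffOn ℝ ∞ N (U : Set E3) →
        (Kerr.smoothMetric M 0 r₀).IsSpacelikeImmersion 𝓘(ℝ, E3) f →
        (Kerr.smoothMetric M 0 r₀).IsUnitNormal 𝓘(ℝ, E3) f ν (-1) →
        ∃ D : InitialDataSet 𝓘(ℝ, E3) U,
          (∀ y : U, D.h.inner y = (Kerr.smoothMetric M 0 r₀).inducedBilin 𝓘(ℝ, E3) f y) ∧
          (∀ [(Kerr.smoothMetric M 0 r₀).HasLeviCivita] (y : U),
            (D.k y).toLinearMap₁₂ = (Kerr.smoothMetric M 0 r₀).secondFundamentalForm 𝓘(ℝ, E3) f ν y) ∧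
          (∀ [D.metric.HasLeviCivita], D.IsVacuumConstraintSolution)) →
      ContDiff ℝ ∞ (Negative.bentHeight M 0) →
      (∀ (Ω : TopologicalSpace.Opens E3), (Ω : Set E3) = {y : E3 | M / 40 < ‖y‖ ∧ ‖y‖ < 3 * M / 4} →
        ∃ Db : InitialDataSet 𝓘(ℝ, E3) Ω,
          (∀ [Db.metric.HasLeviCivita], Db.IsVacuumConstraintSolution) ∧
          (∀ y : Ω, ‖(y : E3)‖ < M / 30 →
            (∀ v w : E3, Db.h.inner y v w = Schwarzschild.conformalFactor M (y : E3) ^ 4 * ⟪v, w⟫_ℝ) ∧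
              Db.k y = 0) ∧
          (∀ y : Ω, 7 * M / 10 < ‖(y : E3)‖ →
            (∀ v w : E3, Db.h.inner y v w = Kerr.hRep M (y : E3) v w) ∧
              (∀ v w : E3, Db.k y v w = Kerr.kRep M (y : E3) v w))) →
      ∀ (r₁ : ℝ), 3 * M / 4 < r₁ → r₁ < 2 * M →
        (Kerr.smoothMetric M 0 r₁).IsSpacelikeImmersion 𝓘(ℝ, E3) (Negative.graph M 0 r₁) →
        ∀ (N₀ : E3 → E4), ContDiffOn ℝ ∞ N₀ (Kerr.slice 0 r₁ : Set E3) →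
          (Kerr.smoothMetric M 0 r₁).IsFutureUnitNormal 𝓘(ℝ, E3) ((Kerr.timeOrientation M 0 r₁ hM).ofLE le_top)
            (Negative.graph M 0 r₁) (fun y ↦ N₀ y) →
          ∃ D : InitialDataSet (𝓡 3) E3,
            (∀ [D.metric.HasLeviCivita], D.IsVacuumConstraintSolution) ∧
            (∃ R : ℝ, 0 < R ∧ ∀ y : E3, R < ‖y‖ →
              (∀ v w : E3, D.h.inner y v w = Schwarzschild.conformalFactor M y ^ 4 * ⟪v, w⟫_ℝ) ∧ D.k y = 0) ∧
            ∃ (a r₁ : ℝ) (hM : 0 ≤ M) (T : ℝ → ℝ) (φ : Literature.Geometry.Lorentzian.Kerr.slice a r₁ → Literature.Geometry.Lorentzian.E3) (ψ : Literature.Geometry.Lorentzian.Kerr.slice a r₁ → Literature.Geometry.Lorentzian.Kerr.region a r₁) (ν : Literature.Geometry.Lorentzian.NormalField 𝓘(ℝ, Literature.Geometry.Lorentzian.E4) ψ), |a| < M ∧ Literature.Geometry.Lorentzian.Kerr.rMinus M a < r₁ ∧ r₁ < Literature.Geometry.Lorentzian.Kerr.rPlus M a ∧ T = (fun r : ℝ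 => Real.smoothTransition (r / (4 * M) - 1) * (((M) / Real.sqrt ((M) ^ 2 - (a) ^ 2)) * (Literature.Geometry.Lorentzian.Kerr.rPlus M a * Real.log (r - Literature.Geometry.Lorentzian.Kerr.rPlus M a) - Literature.Geometry.Lorentzian.Kerr.rMinus M a * Real.log (r - Literature.Geometry.Lorentzian.Kerr.rMinus M a)) - ((M) / Real.sqrt ((M) ^ 2 - (a) ^ 2)) * (Literature.Geometry.Lorentzian.Kerr.rPlus M a * Real.log ((4 * M) - Literature.Geometry.Lorentzian.Kerr.rPlus M a) - Literature.Geometry.Lorentzian.Kerr.rMinus M a * Real.log ((4 * M) - Literature.Geometry.Lorentzian.Kerr.rMinus M a)))) ∧ IsCompact (Set.range φ)ᶜ ∧ Topology.IsOpenEmbedding φ ∧ ContMDiff 𝓘(ℝ, Literature.Geometry.Lorentzian.E3) (𝓡 3) ((⊤ : ℕ∞) : WithTop ℕ∞) φ ∧ (∀ y : Literature.Geometry.Lorentzian.Kerr.slice a r₁, (ψ y : Literature.Geometry.Lorentzian.E4) = Literature.Geometry.Lorentzian.E4.ofTimeSpace (T (Literature.Geometry.Lorentzian.Kerr.radius a (Literature.Geometry.Lorentzian.E4.ofTimeSpace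 0 (y : Literature.Geometry.Lorentzian.E3)))) (y : Literature.Geometry.Lorentzian.E3)) ∧ (Literature.Geometry.Lorentzian.Kerr.smoothMetric M a r₁).IsSpacelikeImmersion 𝓘(ℝ, Literature.Geometry.Lorentzian.E3) ψ ∧ (Literature.Geometry.Lorentzian.Kerr.smoothMetric M a r₁).IsFutureUnitNormal 𝓘(ℝ, Literature.Geometry.Lorentzian.E3) ((Literature.Geometry.Lorentzian.Kerr.timeOrientation M a r₁ hM).ofLE le_top) ψ ν ∧ (∀ y : Literature.Geometry.Lorentzian.Kerr.slice a r₁, Literature.Geometry.Lorentzian.pullbackBilin (I := 𝓡 3) (I' := 𝓘(ℝ, Literature.Geometry.Lorentzian.E3)) φ (D).h.inner y = Literature.Geometry.Lorentzian.pullbackBilin (I := 𝓘(ℝ, Literature.Geometry.Lorentzian.E4)) (I' := 𝓘(ℝ, Literature.Geometry.Lorentzian.E3)) ψ (Literature.Geometry.Lorentzian.Kerr.smoothMetric M a r₁).val y) ∧ (∀ [(Literature.Geometry.Lorentzian.Kerr.smoothMetric M a r₁).HasLeviCivita] (y : Literature.Geometry.Lorentzian.Kerr.slice a r₁), (Literature.Geometry.Lorentzian.pullbackBilin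 (I := 𝓡 3) (I' := 𝓘(ℝ, Literature.Geometry.Lorentzian.E3)) φ (D).k y).toLinearMap₁₂ = (Literature.Geometry.Lorentzian.Kerr.smoothMetric M a r₁).secondFundamentalForm 𝓘(ℝ, Literature.Geometry.Lorentzian.E3) ψ ν y) := by
  intro _ M ρ₃ D₀ hM hM0 _ hρ₃M hvac₀ hexact₀ hRic hInd _ hBridge r₁ hr₁a hr₁b hsp N₀ hN₀ hν
  have hr₁ : 0 < r₁ := by linarith
  have hr₁4 : r₁ < 4 * M := by linarith
  have h0 : |(0 : ℝ)| < M := by rwa [abs_zero]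
  -- the radial profile of the end chart
  obtain ⟨Q, S, hQs, hSs, hQm, hSm, hSQ, hQS, hQid, hSid, hQfar, -⟩ := exists_radialProfile hM0
  -- the bridge datum
  have hΩo : IsOpen {y : E3 | M / 40 < ‖y‖ ∧ ‖y‖ < 3 * M / 4} :=
    (isOpen_lt continuous_const continuous_norm).inter (isOpen_lt continuous_norm continuous_const)
  obtain ⟨Db, hDbvac, hDbin, hDbout⟩ := hBridge ⟨{y : E3 | M / 40 < ‖y‖ ∧ ‖y‖ < 3 * M / 4}, hΩo⟩ rfl
  -- the Kerr–Schild zone datum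
  obtain ⟨DK, hDKvac, hDK⟩ := exists_ksZoneData hM (7 * M / 10)
    (fun U Φ N f ν ↦ hInd (7 * M / 10) U Φ N f ν (hRic _))
  -- the leaf zone
  obtain ⟨φ, ψ, Dl, hφ, hψφ, hφψ, hφs, hψs, hDlvac, hDlnear, hDlfar, hDlh, hDlk⟩ :=
    exists_leafZoneData hM hM0 hr₁ hr₁4 (fun U Φ N f ν ↦ hInd r₁ U Φ N f ν (hRic _)) hsp hN₀ hν
      hQs hSs hQm hSm hSQ hQS hQid hSid hQfar
  -- the glued datum
  obtain ⟨D, hDvac, hDL⟩ := exists_zonesData hM0 hρ₃M hr₁a hr₁b D₀ hvac₀ hexact₀ rfl Db hDbvac hDbin hDbout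
    DK hDKvac hDK Dl hDlvac hDlnear
  refine ⟨D, hDvac, ⟨7 * M, by positivity, fun y hy ↦ ?_⟩, 0, r₁, hM, Negative.bentHeight M 0,
    fun y ↦ (φ y : E3), Negative.graph M 0 r₁, fun y ↦ N₀ y, h0, ?_, ?_, Negative.bentHeight_eq_literal M 0,
    ?_, ?_, ?_, fun _ ↦ rfl, hsp, hν, ?_, ?_⟩
  · -- the far clause: isotropic Schwarzschild beyond `7M`
    have hyL : y ∈ Kerr.slice 0 r₁ := mem_slice_zero_of_lt hr₁.le (by linarith)
    obtain hfar := hDlfar ⟨y, hyL⟩ hy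
    refine ⟨fun v w ↦ ?_, ContinuousLinearMap.ext fun v ↦ ContinuousLinearMap.ext fun w ↦ ?_⟩
    · rw [(hDL y hyL v w).1]; exact (hfar v w).1
    · rw [(hDL y hyL v w).2]; exact (hfar v w).2
  · -- `r₋ = 0 < r₁`
    have h := Negative.rPlus_add_rMinus M 0
    rw [Kerr.rPlus_zero_right hM] at h
    linarith
  · -- `r₁ < r₊ = 2M`
    rw [Kerr.rPlus_zero_right hM]; exact hr₁b
  · -- compact complement of the end chart: the closed ball of radius `r₁`
    have hrange : Set.range (fun y : Kerr.slice 0 r₁ ↦ (φ y : E3)) = {z : E3 | r₁ < ‖z‖} := by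
      ext z
      constructor
      · rintro ⟨y, rfl⟩
        exact lt_norm_of_mem_slice_zero hr₁.le (φ y).2
      · intro hz
        exact ⟨ψ ⟨z, mem_slice_zero_of_lt hr₁.le hz⟩, by
          show ((φ (ψ ⟨z, mem_slice_zero_of_lt hr₁.le hz⟩) : Kerr.slice 0 r₁) : E3) = z; rw [hφψ]⟩
    have hcompl : (Set.range (fun y : Kerr.slice 0 r₁ ↦ (φ y : E3)))ᶜ = Metric.closedBall (0 : E3) r₁ := by
      rw [hrange]
      ext z
      simp [Metric.mem_closedBall, dist_zero_right, not_lt]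
    rw [hcompl]
    exact isCompact_closedBall 0 r₁
  · -- open embedding: a self-homeomorphism of the slice followed by the inclusion
    let H : Kerr.slice 0 r₁ ≃ₜ Kerr.slice 0 r₁ :=
      { toFun := φ, invFun := ψ, left_inv := hψφ, right_inv := hφψ,
        continuous_toFun := hφs.continuous, continuous_invFun := hψs.continuous }
    exact (Kerr.slice 0 r₁).isOpen.isOpenEmbedding_subtypeVal.comp H.isOpenEmbedding
  · -- smooth
    exact contMDiff_subtype_val.comp hφs
  · -- the pull-back identity for `h`
    intro y
    have hφd : MDifferentiableAt 𝓘(ℝ, E3) 𝓘(ℝ, E3) φ y := hφs.mdifferentiableAt (by simp)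
    have hdE : ∀ u : E3, mfderiv 𝓘(ℝ, E3) (𝓡 3) (fun y : Kerr.slice 0 r₁ ↦ (φ y : E3)) y u =
        mfderiv 𝓘(ℝ, E3) 𝓘(ℝ, E3) φ y u := fun u ↦ by
      have h := mfderiv_comp y (OpenSubmanifold.mdifferentiableAt_subtype_val (φ y)) hφd
      rw [OpenSubmanifold.mfderiv_subtype_val] at h
      exact congrArg (fun L : E3 →L[ℝ] E3 ↦ L u) h
    ext v w
    rw [pullbackBilin_apply, pullbackBilin_apply, hdE v, hdE w, (hDL (φ y : E3) (φ y).2 _ _).1]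
    exact hDlh y v w
  · -- the pull-back identity for `k`
    intro _ y
    have hφd : MDifferentiableAt 𝓘(ℝ, E3) 𝓘(ℝ, E3) φ y := hφs.mdifferentiableAt (by simp)
    have hdE : ∀ u : E3, mfderiv 𝓘(ℝ, E3) (𝓡 3) (fun y : Kerr.slice 0 r₁ ↦ (φ y : E3)) y u =
        mfderiv 𝓘(ℝ, E3) 𝓘(ℝ, E3) φ y u := fun u ↦ by
      have h := mfderiv_comp y (OpenSubmanifold.mdifferentiableAt_subtype_val (φ y)) hφd
      rw [OpenSubmanifold.mfderiv_subtype_val] at h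
      exact congrArg (fun L : E3 →L[ℝ] E3 ↦ L u) h
    refine LinearMap.ext fun v ↦ LinearMap.ext fun w ↦ ?_
    have hlhs : (pullbackBilin (I := 𝓡 3) (I' := 𝓘(ℝ, E3)) (fun y : Kerr.slice 0 r₁ ↦ (φ y : E3)) D.k y).toLinearMap₁₂ v w
        = D.k (φ y : E3) (mfderiv 𝓘(ℝ, E3) (𝓡 3) (fun y : Kerr.slice 0 r₁ ↦ (φ y : E3)) y v)
          (mfderiv 𝓘(ℝ, E3) (𝓡 3) (fun y : Kerr.slice 0 r₁ ↦ (φ y : E3)) y w) := rfl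
    rw [hlhs, hdE v, hdE w, (hDL (φ y : E3) (φ y).2 _ _).2]
    exact hDlk y v w

end Summit.FinalStateConjecture.FinalStateConjecture.Theorems.SwallowTheDatum

end
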